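import Literature.ModelTheory.ExponentialFields.DecidableTheory
import Literature.ModelTheory.ProofTheory.Completeness
import Literature.ModelTheory.ProofTheory.CheckerSoundness
import Literature.ModelTheory.ProofTheory.CheckerCompleteness
import Literature.ModelTheory.ProofTheory.SentenceCodes

/-!
# The enumerability theorem: proof of `Theory.IsComputablyAxiomatizable.isRE`

We discharge the named fact `FirstOrder.Language.Theory.IsComputablyAxiomatizable.isRE` of
`Literature/ModelTheory/ExponentialFields/DecidableTheory.lean`: in a recursively presented
language, the set of Gödel numbers of the consequences of a computably axiomatizable theory is
recursively enumerable (Enderton, *A Mathematical Introduction to Logic*: §2.5 Enumerability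
Theorem and Corollary 25F(b) — "for a decidable `Γ` in a reasonable language, `{φ | Γ ⊨ φ}` is
effectively enumerable" —, made precise in §3.5 as **Theorem 35I**: "if `A` is a set of sentences
such that `#A` is recursive, then `#Cn A` is recursively enumerable". The fact's own docstring
gives the locator "Cor. 35B"; in the numbering of the text the result is Theorem 35I of §3.5, and
Corollary 26F(a) of §2.6 in its informal form.)

## Proof

Exactly Enderton's: by the completeness theorem for a Hilbert calculus
(`Literature.ModelTheory.ProofTheory.PreFOL.provable_iff_models`, `Literature/ModelTheory/ProofTheory/Completeness.lean`),
`T ⊨ᵇ φ ↔ A ⊨ᵇ φ ↔ Provable (ofBounded '' A) (ofBounded φ)`; deductions are checked by the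
arithmetised proof checker of `Literature/ModelTheory/ProofTheory/Checker.lean`, which is
computable relative to the arity tables of the language (computable because the language is
recursively presented, `IsRecursivelyPresented.computable_arityF`) and to membership in `A`
(computable because `A` is recursive), and which is sound and complete for the calculus and for
Mathlib's Gödel numbering (`check_sound`, `exists_check_of_provable`); an unbounded search over
certificates (`rePred_exists_check`) then enumerates the theorems.

## Main statements

* `FirstOrder.Language.Theory.IsComputablyAxiomatizable.isRE_holds` [cite: Enderton2001, §3.5 Thm. 35I].

## Design

As in the statement file, the declarations live in Mathlib's namespaces `FirstOrder.Language.*`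
(deliberate dot-notation extensions: `IsRecursivelyPresented.computable_arityF`, and the discharge
`Theory.IsComputablyAxiomatizable.isRE_holds` next to the fact it proves). The proof-theoretic
machinery (`Literature.PreFOL.*`) is in `Literature/ModelTheory/ProofTheory/`.

## References

* H. B. Enderton, *A Mathematical Introduction to Logic*, Academic Press (1972; 2nd ed.
  Harcourt/Academic Press 2001), §2.5 (Enumerability Theorem, Cor. 25F), §2.6 (Cor. 26F),
  §3.4 (arithmetization of syntax), §3.5 (Thm. 35I).
-/

namespace FirstOrder.Language

open Literature.ModelTheory.ProofTheory.PreFOL Encodable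

variable {L : Language} [Encodable (Σ i, L.Functions i)] [Encodable (Σ i, L.Relations i)]

namespace IsRecursivelyPresented

omit [Encodable (Σ i, L.Relations i)] in
/-- The arity table of function-symbol codes as a case distinction on the two maps
`n ↦ (decode n).map encode` and `n ↦ (decode n).map Sigma.fst`. [folklore] -/
theorem arityF_eq_cond (n : ℕ) : arityF L n =
    bif decide ((decode (α := Σ i, L.Functions i) n).map encode = some n) then
      (decode (α := Σ i, L.Functions i) n).map Sigma.fst else none := by
  unfold arityF
  cases decode (α := Σ i, L.Functions i) n with
  | none => simp
  | some F => by_cases h : encode F = n <;> simp [h]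

omit [Encodable (Σ i, L.Functions i)] in
/-- The arity table of relation-symbol codes as a case distinction. [folklore] -/
theorem arityR_eq_cond (n : ℕ) : arityR L n =
    bif decide ((decode (α := Σ i, L.Relations i) n).map encode = some n) then
      (decode (α := Σ i, L.Relations i) n).map Sigma.fst else none := by
  unfold arityR
  cases decode (α := Σ i, L.Relations i) n with
  | none => simp
  | some R => by_cases h : encode R = n <;> simp [h]

/-- In a recursively presented language the arity table of function-symbol codes is computable.
[folklore] -/
theorem computable_arityF (hL : L.IsRecursivelyPresented) : Computable (arityF L) := by
  have hc : Computable fun n : ℕ =>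
      decide ((decode (α := Σ i, L.Functions i) n).map encode = some n) :=
    Computable₂.comp (Primrec.eq (α := Option ℕ)).decide.to_comp
      hL.computable_encode_decode_functions (Computable.option_some.comp Computable.id)
  exact (Computable.cond hc hL.computable_arity_functions (Computable.const none)).of_eq
    fun n => (arityF_eq_cond n).symm

/-- In a recursively presented language the arity table of relation-symbol codes is computable.
[folklore] -/
theorem computable_arityR (hL : L.IsRecursivelyPresented) : Computable (arityR L) := by
  have hc : Computable fun n : ℕ =>
      decide ((decode (α := Σ i, L.Relations i) n).map encode = some n) :=
    Computable₂.comp (Primrec.eq (α := Option ℕ)).decide.to_comp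
      hL.computable_encode_decode_relations (Computable.option_some.comp Computable.id)
  exact (Computable.cond hc hL.computable_arity_relations (Computable.const none)).of_eq
    fun n => (arityR_eq_cond n).symm

end IsRecursivelyPresented

namespace Theory

/-- **Theoremhood is checkable**: for a recursive set of axioms `A` (membership oracle `memA`)
in a language with encodable symbols, `n` is the Gödel number of a consequence of `A` iff some
certificate for `n` is accepted by the arithmetised proof checker run with the arity tables of
`L` (completeness theorem + soundness and completeness of the checker). [folklore] -/
theorem exists_models_iff_exists_check {A : L.Theory} {memA : ℕ → Bool}
    (hmem : ∀ n, memA n = true ↔ ∃ φ ∈ A, Sentence.godelNumber φ = n) (n : ℕ) :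
    (∃ φ : L.Sentence, A ⊨ᵇ φ ∧ φ.godelNumber = n) ↔
      ∃ c : List (List ℕ), check (arityF L) (arityR L) memA n c = true := by
  set S : Set PreFormula := PreFormula.ofBounded '' (A : Set L.Sentence) with hSdef
  have hS0 : ∀ ψ ∈ S, ψ.params = ∅ := by
    rintro ψ ⟨χ, _, rfl⟩
    exact PreFormula.params_ofBounded χ
  have hAS : ∀ ψ : L.Sentence, memA (encode ψ) = true → PreFormula.ofBounded ψ ∈ S := by
    intro ψ h
    obtain ⟨φ, hφ, he⟩ := (hmem _).1 h
    obtain rfl : φ = ψ := encode_injective he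
    exact ⟨φ, hφ, rfl⟩
  have hSA : ∀ ψ ∈ S, ∃ χ : L.Sentence, PreFormula.ofBounded χ = ψ ∧ memA (encode χ) = true := by
    rintro ψ ⟨χ, hχ, rfl⟩
    exact ⟨χ, rfl, (hmem _).2 ⟨χ, hχ, rfl⟩⟩
  have harF : ∀ {n} (F : L.Functions n),
      arityF L (encode (⟨n, F⟩ : Σ i, L.Functions i)) = some n := fun F => arityF_encode F
  have harR : ∀ {n} (R : L.Relations n),
      arityR L (encode (⟨n, R⟩ : Σ i, L.Relations i)) = some n := fun R => arityR_encode R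
  constructor
  · rintro ⟨φ, hφ, rfl⟩
    exact exists_check_of_provable harF harR hSA (provable_iff_models.2 hφ)
  · rintro ⟨c, hc⟩
    obtain ⟨φ, hφn, hprov⟩ := check_sound hS0 hAS hc
    exact ⟨φ, provable_iff_models.1 hprov, hφn⟩

/-- **Enumerability theorem** (Enderton, *A Mathematical Introduction to Logic*, §3.5
Theorem 35I: "If `A` is a set of sentences such that `#A` is recursive, then `#Cn A` is
recursively enumerable"; informally §2.5 Enumerability Theorem / Cor. 25F(b) and §2.6 Cor. 26F(a),
for a "reasonable" = recursively presented language): the named fact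
`Theory.IsComputablyAxiomatizable.isRE` holds. Proof: Gödel's completeness theorem for the
Hilbert calculus on pre-sentences (`Literature.ModelTheory.ProofTheory.PreFOL.provable_iff_models`), the computable, sound and
complete arithmetised proof checker (`Literature.ModelTheory.ProofTheory.PreFOL.computable_check`, `check_sound`,
`exists_check_of_provable`), and unbounded search (`Literature.ModelTheory.ProofTheory.PreFOL.rePred_exists_check`).
[cite: Enderton2001, §3.5 Thm. 35I] -/
theorem IsComputablyAxiomatizable.isRE_holds : IsComputablyAxiomatizable.isRE (L := L) := by
  intro hL T hT
  obtain ⟨A, hA, hAT⟩ := hT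
  obtain ⟨memA, hmemA, hp⟩ := ComputablePred.computable_iff.1 hA
  have hmem : ∀ n, memA n = true ↔ ∃ φ ∈ A, Sentence.godelNumber φ = n := fun n =>
    (iff_of_eq (congrFun hp n)).symm
  have hre := rePred_exists_check hL.computable_arityF hL.computable_arityR hmemA
  refine hre.of_eq fun n => ?_
  rw [← exists_models_iff_exists_check hmem n]
  constructor
  · rintro ⟨φ, hφ, hn⟩
    exact ⟨φ, (hAT φ).1 hφ, hn⟩
  · rintro ⟨φ, hφ, hn⟩
    exact ⟨φ, (hAT φ).2 hφ, hn⟩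

end Theory

end FirstOrder.Language


/-!
## Janiczak's theorem: proof of `Theory.isDecidable_of_isComplete_of_isComputablyAxiomatizable`

We discharge the second named fact of `DecidableTheory.lean`: a complete, computably axiomatizable
theory in a recursively presented language is decidable (A. Janiczak, *A remark concerning
decidability of complete theories*, J. Symbolic Logic 15 (1950) 277–279; Enderton, *A
Mathematical Introduction to Logic*, §2.6 Cor. 26I / §3.5; Marker, *Model Theory*, Lemma 2.2.8).

Proof (the textbook one, made total on *all* naturals): by
`Literature.ModelTheory.ProofTheory.PreFOL.computablePred_exists_godelNumber_eq` (`ProofTheory/SentenceCodes.lean`) it is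
decidable whether `n` is the Gödel number of a sentence; if it is not, answer "no"; if
`n = ⌜φ⌝`, search for the first certificate (for the arithmetised checker of `Checker.lean`, run
on a recursive axiom set `A` with the same consequences as `T`) establishing either `⌜φ⌝` or
`⌜¬φ⌝ = ⌜φ ⟹ ⊥⌝` (computed from `n` on the letters); by completeness of `T` one of the two exists
(`exists_models_iff_exists_check` and Gödel's completeness theorem), and by consistency the
answer read off the certificate found is correct.
-/

namespace FirstOrder.Language.Theory

open Literature.ModelTheory.ProofTheory.PreFOL Encodable Denumerable

variable {L : Language} [Encodable (Σ i, L.Functions i)] [Encodable (Σ i, L.Relations i)]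

/-- The Gödel number of `¬φ = (φ ⟹ ⊥)` is computed from that of `φ` on the letters:
`⌜¬φ⌝ = ⟨3 :: letters φ ++ [11]⟩`. [folklore] -/
theorem godelNumber_not (φ : L.Sentence) :
    Sentence.godelNumber φ.not = encode (3 :: (ofNat (List ℕ) φ.godelNumber ++ [11])) := by
  rw [godelNumber_eq, godelNumber_eq, ofNat_encode, show φ.not = φ.imp ⊥ from rfl,
    formulaLetters_imp, show (⊥ : L.BoundedFormula Empty 0) = BoundedFormula.falsum from rfl,
    formulaLetters_falsum]

/-- **Janiczak's theorem** (Janiczak 1950; Enderton 2001, §2.6 Cor. 26I; Marker 2002,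
Lemma 2.2.8): the named fact `Theory.isDecidable_of_isComplete_of_isComputablyAxiomatizable`
holds — in a recursively presented language, a complete computably axiomatizable theory is
decidable. [cite: Janiczak1950] -/
theorem isDecidable_of_isComplete_of_isComputablyAxiomatizable_holds :
    isDecidable_of_isComplete_of_isComputablyAxiomatizable (L := L) := by
  intro hL T hc hax
  classical
  obtain ⟨A, hA, hAT⟩ := hax
  obtain ⟨memA, hmemA, hp⟩ := ComputablePred.computable_iff.1 hA
  have hmem : ∀ n, memA n = true ↔ ∃ φ ∈ A, Sentence.godelNumber φ = n := fun n =>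
    (iff_of_eq (congrFun hp n)).symm
  -- theoremhood of `T` via certificates for `A`
  have hS : ∀ n, (∃ φ : L.Sentence, T ⊨ᵇ φ ∧ φ.godelNumber = n) ↔
      ∃ c, check (arityF L) (arityR L) memA n c = true := fun n => by
    rw [← exists_models_iff_exists_check hmem n]
    exact ⟨fun ⟨φ, h, e⟩ => ⟨φ, (hAT φ).2 h, e⟩, fun ⟨φ, h, e⟩ => ⟨φ, (hAT φ).1 h, e⟩⟩
  -- decidability of sentence codes
  obtain ⟨isC, hisC, hisCp⟩ := ComputablePred.computable_iff.1
    (computablePred_exists_godelNumber_eq (L := L) hL.computable_arityF hL.computable_arityR)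
  have hisC' : ∀ n, isC n = true ↔ ∃ φ : L.Sentence, φ.godelNumber = n := fun n =>
    (iff_of_eq (congrFun hisCp n)).symm
  -- the code of the negation, and the search predicate
  let N : ℕ → ℕ := fun n => encode (3 :: (ofNat (List ℕ) n ++ [11]))
  let chk : ℕ → List (List ℕ) → Bool := check (arityF L) (arityR L) memA
  let P : ℕ × ℕ → Bool := fun q =>
    chk q.1 (ofNat (List (List ℕ)) q.2) || chk (N q.1) (ofNat (List (List ℕ)) q.2)
  have hchk : Computable₂ chk := computable_check hL.computable_arityF hL.computable_arityR hmemA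
  have hNc : Computable N :=
    (Primrec.encode.comp (Primrec.list_cons.comp (Primrec.const 3)
      (Primrec.list_append.comp (Primrec.ofNat (List ℕ)) (Primrec.const [11])))).to_comp
  have hchk1 : Computable fun q : ℕ × ℕ => chk q.1 (ofNat (List (List ℕ)) q.2) :=
    hchk.comp Computable.fst ((Computable.ofNat _).comp Computable.snd)
  have hP : Computable P :=
    (Primrec.or.to_comp).comp hchk1
      (hchk.comp (hNc.comp Computable.fst) ((Computable.ofNat _).comp Computable.snd))
  -- the decision procedure: off the sentence codes answer `false`; on `⌜φ⌝` find the first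
  -- certificate for `⌜φ⌝` or `⌜¬φ⌝` and answer accordingly
  let D : ℕ →. Bool := fun n => cond (isC n)
    ((Nat.rfind fun m => Part.some (P (n, m))).map fun m => chk n (ofNat (List (List ℕ)) m))
    (Part.some false)
  have hD : Partrec D :=
    Partrec.cond hisC ((Partrec.rfind hP.partrec.to₂).map hchk1.to₂)
      (Computable.const false).partrec
  let g : ℕ → Bool := fun n => decide (∃ φ : L.Sentence, T ⊨ᵇ φ ∧ φ.godelNumber = n)
  have key : ∀ n, g n ∈ D n := by
    intro n
    cases hcn : isC n with
    | false =>
      have : ¬ ∃ φ : L.Sentence, T ⊨ᵇ φ ∧ φ.godelNumber = n := fun ⟨φ, _, e⟩ => by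
        have := (hisC' n).2 ⟨φ, e⟩
        rw [hcn] at this
        exact Bool.false_ne_true this
      simp [D, g, hcn, this]
    | true =>
      obtain ⟨φ, rfl⟩ := (hisC' n).1 hcn
      have hNφ : N φ.godelNumber = Sentence.godelNumber φ.not := (godelNumber_not φ).symm
      have hex : ∃ m, P (φ.godelNumber, m) = true := by
        rcases hc.2 φ with h | h
        · obtain ⟨c, hc'⟩ := (hS _).1 ⟨φ, h, rfl⟩
          exact ⟨encode c, by simp [P, chk, hc']⟩
        · obtain ⟨c, hc'⟩ := (hS _).1 ⟨φ.not, h, rfl⟩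
          refine ⟨encode c, ?_⟩
          simp only [P, chk, Bool.or_eq_true, Denumerable.ofNat_encode, hNφ]
          exact Or.inr hc'
      have hm₀ : Nat.find hex ∈ Nat.rfind fun m => Part.some (P (φ.godelNumber, m)) := by
        refine Nat.mem_rfind.2 ⟨by simp [Nat.find_spec hex], fun {m} hm => ?_⟩
        have := Nat.find_min hex hm
        simp only [Bool.not_eq_true] at this
        simp [this]
      simp only [D, hcn, cond_true]
      refine (Part.mem_map_iff _).2 ⟨Nat.find hex, hm₀, ?_⟩
      -- the answer read off the first certificate is correct
      cases hck : chk φ.godelNumber (ofNat (List (List ℕ)) (Nat.find hex)) with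
      | true =>
        have hSn : ∃ ψ : L.Sentence, T ⊨ᵇ ψ ∧ ψ.godelNumber = φ.godelNumber := (hS _).2 ⟨_, hck⟩
        simp [g, hSn]
      | false =>
        have hPm : P (φ.godelNumber, Nat.find hex) = true := Nat.find_spec hex
        simp only [P, hck, Bool.false_or] at hPm
        have hPm' : chk (Sentence.godelNumber φ.not) (ofNat (List (List ℕ)) (Nat.find hex)) =
            true := by
          rw [← hNφ]; exact hPm
        obtain ⟨ψ, hψ, he⟩ := (hS _).2 ⟨_, hPm'⟩
        obtain rfl : ψ = φ.not := Sentence.godelNumber_injective he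
        have hnot : ¬ T ⊨ᵇ φ := (hc.models_not_iff φ).1 hψ
        have : ¬ ∃ χ : L.Sentence, T ⊨ᵇ χ ∧ χ.godelNumber = φ.godelNumber := by
          rintro ⟨χ, hχ, he'⟩
          obtain rfl : χ = φ := Sentence.godelNumber_injective he'
          exact hnot hχ
        simp [g, this]
  have hg : Computable g := Partrec.of_eq_tot hD key
  exact ComputablePred.computable_iff.2 ⟨g, hg, funext fun n => by simp [g]⟩

end FirstOrder.Language.Theory
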